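import Summits.QuantumAdvantage.QuantumAdvantage.Theorems.SosSandwichTransferPBAveragedPotential
import Literature.Computability.QuantumComplexity.HybridArgument
import HarnessLib

/-!
# Crux `TransferPB` (stmt-QuantumAdvantage-15238, route SosSandwich), line `birth` — BBBV query magnitudes bound the influences of restricted acceptance polynomials; the machine reduction, BBBV FORM

Obligation (B) of the machine half of stub `stub_pbOracleSimulation`, DISCHARGED from the tree's hybrid argument
(`Literature/Computability/QuantumComplexity/HybridArgument.lean`: `l2Norm_toMatrix_sub_le`,
`sum_map_two_mul_sqrt_le`, `sum_sum_queryWeights_le`, `QCircuit.abs_acceptProb_sub_le`). For an oracle circuit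
family `F`, an input `x`, and the total query magnitude
`W_q(A) = Σ_t q_{{q}}(|φ_t^A⟩)` of the string `q` in the run of `F` on `x` under `A`
(`(queryWeights A {q} (F.circ |x|).gates |x,0⟩).sum`):

* `sq_acceptProbOn_sub_le_queryWeights` — if `A`, `B` differ only at `q`:
  `(Pr[F^B accepts x] − Pr[F^A accepts x])² ≤ 4·T·W_q(A)` (`T` = number of oracle gates);
* `evalBool_restrictPath`, `foldr_update_flipBit`, `oracleOf_flipBit_iff` — bookkeeping: restriction along a
  path is evaluation at the overridden point; overriding commutes with flipping a free bit; flipping the relevant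
  bit `s` changes the oracle `oracleOf b` only at its string `σ(s)`;
* **`influence_restrictPath_acceptPoly_le`** — for a FREE bit `s ∉ dom ρ`:
  `Inf_s[p_x|_ρ] ≤ E_y[ 4T·W_{σ(s)}(oracleOf (y ◁ ρ)) ]` — the averaged BBBV magnitude;
* `sum_boolAvg_bbbvWeight_le` — `Σ_s E_y[4T·W_{σ(s)}(oracleOf y)] ≤ 4T²` (total query magnitude `≤ T`);
* **`oracleSimulation_of_bbbvMachines`**, **`stub_pbOracleSimulation_of_bbbvMachines`** — the stub from the
  machine hypothesis in BBBV FORM: the machine's advisor picks FRESH bits whose averaged magnitude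
  `m_s(ρ) = E_y[4T·W_{σ(s)}(oracleOf (y ◁ ρ))]` is `≥ τ`, its refusals certify `m_s(ρ) < w` for every FREE bit
  (no influence, no variance, no BBBV left to the machine-prover), leaf values are `1/20`-accurate, the budget
  is `D ≥ max(1, 8T²/(τδ))`, and `C^{A ⊕ g}(x)` is the threshold bit of the advised tree.

All proved; no named fact (the machine hypothesis is a plain `Prop` argument, D-0026). What remains for the stub:
ONE promise problem in `PromiseBQP` answering gapped block-magnitude tests and mean thresholds (Q), and the
polynomial-time transcript machine walking the advised tree by heavy-prefix descent (M). Sources: C. H. Bennett,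
E. Bernstein, G. Brassard, U. Vazirani, SIAM J. Comput. 26 (1997), Thm. 3.3 / Cor. 3.4; S. Aaronson,
A. Ambainis, Theory Comput. 10 (2014), Thm. 21/23 (arXiv:0911.0996v3 pp. 13–14).
-/

-- D-0017: single-conjunct summit ⇒ the duplicate `QuantumAdvantage.QuantumAdvantage` is mandated.
set_option linter.dupNamespace false

noncomputable section

namespace Summit.QuantumAdvantage.QuantumAdvantage.Cruxes.TransferPB.Birth

open Finset MeasureTheory Literature.Computability.Cryptography Literature.Computability.Complexity
  Literature.Computability.QuantumComplexity Literature.Computability.QuantumComplexity.ClassicalSimulation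
open Summit.QuantumAdvantage.QuantumAdvantage.Theses.SosSandwich
open scoped ENNReal

namespace SimTreePB

/-! ### BBBV for one flipped string -/

section OneString

variable {G : QGateSet} (F : QCircuitFamily G) (x : List Bool)

/-- **BBBV for one modified string, squared form.** If the oracles `A`, `B` differ only at the string `q`,
then `(Pr[F^B accepts x] − Pr[F^A accepts x])² ≤ 4·T·W_q(A)`, where `T` is the number of oracle gates of
`F.circ |x|` and `W_q(A)` the total query magnitude of `q` along the `A`-run
(`|ΔP| ≤ ‖Δφ‖₂ ≤ Σ_t 2√(q_t) ≤ 2√(T Σ_t q_t)`). [cite: BennettBernsteinBrassardVazirani1997, Thm. 3.3 and Cor. 3.4 (proof)] -/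
theorem sq_acceptProbOn_sub_le_queryWeights (hG : G.IsUnitary) {A B : Language Bool} {q : List Bool}
    (hAB : ∀ w, w ≠ q → (w ∈ A ↔ w ∈ B)) :
    (F.acceptProbOn B x - F.acceptProbOn A x) ^ 2 ≤
      4 * ((F.circ x.length).oracleQueries : ℝ) *
        (queryWeights A ({q} : Set (List Bool)) (F.circ x.length).gates
          (basisState (padInput x.get (F.ancillas x.length)))).sum := by
  set ψ0 : QReg (x.length + F.ancillas x.length) → ℂ := basisState (padInput x.get (F.ancillas x.length))
    with hψ0
  set gs := (F.circ x.length).gates with hgs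
  set W : ℝ := (queryWeights A ({q} : Set (List Bool)) gs ψ0).sum with hW
  set T : ℕ := (F.circ x.length).oracleQueries with hT
  have hAB' : ∀ w, w ∉ ({q} : Set (List Bool)) → (w ∈ A ↔ w ∈ B) := fun w hw =>
    hAB w (by simpa using hw)
  have hC : (⟨gs⟩ : QCircuit G (x.length + F.ancillas x.length)) = F.circ x.length := rfl
  have h1 := QCircuit.abs_acceptProb_sub_le hG (F.circ x.length) A B x.get
  have h2 := l2Norm_toMatrix_sub_le hG hAB' gs ψ0
  rw [hC] at h2
  have h3 := sum_map_two_mul_sqrt_le (queryWeights A ({q} : Set (List Bool)) gs ψ0)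
    (queryWeights_nonneg A _ gs ψ0)
  rw [length_queryWeights, hC] at h3
  have hWnn : 0 ≤ W := List.sum_nonneg (queryWeights_nonneg A _ gs ψ0)
  have h4 : |F.acceptProbOn B x - F.acceptProbOn A x| ≤ 2 * Real.sqrt (T * W) := by
    have h12 := h1.trans h2
    exact h12.trans h3
  have hTW : 0 ≤ (T : ℝ) * W := by positivity
  calc (F.acceptProbOn B x - F.acceptProbOn A x) ^ 2
      = |F.acceptProbOn B x - F.acceptProbOn A x| ^ 2 := (sq_abs _).symm
    _ ≤ (2 * Real.sqrt (T * W)) ^ 2 := pow_le_pow_left₀ (abs_nonneg _) h4 2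
    _ = 4 * (T * W) := by rw [mul_pow, Real.sq_sqrt hTW]; norm_num
    _ = 4 * (T : ℝ) * W := by ring

end OneString

/-! ### Restrictions, overrides and flips -/

section Bookkeeping

variable {N : ℕ}

/-- Restriction along a path is evaluation at the overridden point:
`p|_ρ(y) = p(y ◁ ρ)`, `y ◁ ρ = ρ.foldr (fun (i,b) z => z|ᵢ₌b) y`. [folklore] -/
theorem evalBool_restrictPath : ∀ (ρ : List (Fin N × Bool)) (p : MvPolynomial (Fin N) ℝ) (y : Fin N → Bool),
    evalBool (restrictPath ρ p) y = evalBool p (ρ.foldr (fun ib z => Function.update z ib.1 ib.2) y)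
  | [], _, _ => rfl
  | e :: ρ, p, y => by
    rw [restrictPath_cons, evalBool_restrictPath ρ (restrictPoly e.1 e.2 p) y, evalBool_restrictPoly,
      List.foldr_cons]

/-- Overriding along `ρ` commutes with flipping a bit not on the path. [folklore] -/
theorem foldr_update_flipBit {s : Fin N} : ∀ (ρ : List (Fin N × Bool)), s ∉ ρ.map Prod.fst → ∀ y : Fin N → Bool,
    ρ.foldr (fun ib z => Function.update z ib.1 ib.2) (flipBit s y) =
      flipBit s (ρ.foldr (fun ib z => Function.update z ib.1 ib.2) y)
  | [], _, _ => rfl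
  | e :: ρ, h, y => by
    have hs : e.1 ≠ s := fun hes => h (by simp [hes])
    have h' : s ∉ ρ.map Prod.fst := fun hm => h (by simp [hm])
    rw [List.foldr_cons, List.foldr_cons, foldr_update_flipBit ρ h' y]
    exact update_flipBit_comm (Ne.symm hs) _ _

end Bookkeeping

section Oracles

variable {G : QGateSet} (F : QCircuitFamily G) (x : List Bool)

/-- Flipping the relevant bit `s` changes the oracle `oracleOf b` only at the string named by `s`. [folklore] -/
theorem oracleOf_flipBit_iff (b : Fin (numOracleBits F x) → Bool) (s : Fin (numOracleBits F x))
    (w : List Bool) (hw : w ≠ ((bitEquiv F x).symm s).1) :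
    w ∈ oracleOf F x b ↔ w ∈ oracleOf F x (flipBit s b) := by
  unfold oracleOf
  simp only [Set.mem_setOf_eq]
  have key : ∀ h : w ∈ shortStrings (oracleWidth F x), bitEquiv F x ⟨w, h⟩ ≠ s := by
    intro h heq
    apply hw
    rw [← heq, Equiv.symm_apply_apply]
  constructor
  · rintro ⟨h, hb⟩
    exact ⟨h, by rw [flipBit_apply_of_ne (key h)]; exact hb⟩
  · rintro ⟨h, hb⟩
    exact ⟨h, by rw [flipBit_apply_of_ne (key h)] at hb; exact hb⟩

end Oracles

/-! ### Influences of restricted acceptance polynomials are averaged BBBV magnitudes -/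

section Influence

variable {G : QGateSet} (F : QCircuitFamily G) (x : List Bool)

/-- **`Inf_s[p_x|_ρ] ≤ E_y[4T·W_{σ(s)}(oracleOf (y ◁ ρ))]` for a free bit `s ∉ dom ρ`**: the influence of a
relevant oracle bit on a restriction of the acceptance polynomial is at most the AVERAGED (over the
completions of `ρ`) BBBV weight `4T·W` of its string. [cite: BennettBernsteinBrassardVazirani1997, Thm. 3.3 / Cor. 3.4] -/
theorem influence_restrictPath_acceptPoly_le (hG : G.IsUnitary) (ρ : List (Fin (numOracleBits F x) × Bool))
    (s : Fin (numOracleBits F x)) (hs : s ∉ ρ.map Prod.fst) :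
    influence s (restrictPath ρ (acceptPoly F x)) ≤
      boolAvg (fun y => 4 * ((F.circ x.length).oracleQueries : ℝ) *
        (queryWeights (oracleOf F x (ρ.foldr (fun ib z => Function.update z ib.1 ib.2) y))
          ({((bitEquiv F x).symm s).1} : Set (List Bool)) (F.circ x.length).gates
          (basisState (padInput x.get (F.ancillas x.length)))).sum) := by
  unfold influence boolAvg
  refine div_le_div_of_nonneg_right (Finset.sum_le_sum fun y _ => ?_) (by positivity)
  rw [evalBool_restrictPath, evalBool_restrictPath, foldr_update_flipBit ρ hs y]
  set b := ρ.foldr (fun ib z => Function.update z ib.1 ib.2) y with hb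
  -- `p_x` at a point of the cube is the acceptance probability at the oracle with those bits
  -- (`evalBool_acceptPoly_eq` of `AaronsonAmbainisMoments.lean`, for any gate set)
  have hev : ∀ b' : Fin (numOracleBits F x) → Bool,
      evalBool (acceptPoly F x) b' = F.acceptProbOn (oracleOf F x b') x := fun b' => by
    rw [← oracleBits_oracleOf F x b', evalBool_acceptPoly, oracleBits_oracleOf]
  rw [hev, hev, ← neg_sub, neg_sq]
  exact sq_acceptProbOn_sub_le_queryWeights F x hG (oracleOf_flipBit_iff F x b s)

/-- **Total averaged BBBV weight `≤ 4T²`.** `Σ_s E_y[4T·W_{σ(s)}(oracleOf y)] ≤ 4T²`: for each oracle the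
strings' query magnitudes sum to at most `T` (`sum_sum_queryWeights_le`, unit initial state).
[cite: BennettBernsteinBrassardVazirani1997, Cor. 3.4 (proof)] -/
theorem sum_boolAvg_bbbvWeight_le (hG : G.IsUnitary) :
    ∑ s : Fin (numOracleBits F x), boolAvg (fun y : Fin (numOracleBits F x) → Bool =>
        4 * ((F.circ x.length).oracleQueries : ℝ) *
          (queryWeights (oracleOf F x y) ({((bitEquiv F x).symm s).1} : Set (List Bool))
            (F.circ x.length).gates (basisState (padInput x.get (F.ancillas x.length)))).sum) ≤
      4 * ((F.circ x.length).oracleQueries : ℝ) ^ 2 := by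
  set T : ℕ := (F.circ x.length).oracleQueries with hT
  set gs := (F.circ x.length).gates with hgs
  set ψ0 : QReg (x.length + F.ancillas x.length) → ℂ := basisState (padInput x.get (F.ancillas x.length))
    with hψ0
  have hC : (⟨gs⟩ : QCircuit G (x.length + F.ancillas x.length)) = F.circ x.length := rfl
  -- pointwise in `y`: the sum over the relevant bits is a sum over the short strings, `≤ T`
  have hpt : ∀ y : Fin (numOracleBits F x) → Bool,
      ∑ s : Fin (numOracleBits F x),
          (queryWeights (oracleOf F x y) ({((bitEquiv F x).symm s).1} : Set (List Bool)) gs ψ0).sum ≤ T := by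
    intro y
    have hre : ∑ s : Fin (numOracleBits F x),
        (queryWeights (oracleOf F x y) ({((bitEquiv F x).symm s).1} : Set (List Bool)) gs ψ0).sum =
        ∑ u : OracleVar (oracleWidth F x),
          (queryWeights (oracleOf F x y) ({u.1} : Set (List Bool)) gs ψ0).sum :=
      Equiv.sum_comp (bitEquiv F x).symm
        (fun u : OracleVar (oracleWidth F x) => (queryWeights (oracleOf F x y) ({u.1} : Set (List Bool)) gs ψ0).sum)
    rw [hre, Finset.sum_coe_sort (shortStrings (oracleWidth F x))
      (fun q => (queryWeights (oracleOf F x y) ({q} : Set (List Bool)) gs ψ0).sum)]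
    have h := sum_sum_queryWeights_le hG (oracleOf F x y) (shortStrings (oracleWidth F x)) gs ψ0
    rw [hC, hψ0, normSq_basisState, mul_one] at h
    rw [hψ0]
    exact h
  have hTnn : (0 : ℝ) ≤ 4 * (T : ℝ) := by positivity
  calc ∑ s : Fin (numOracleBits F x), boolAvg (fun y : Fin (numOracleBits F x) → Bool => 4 * (T : ℝ) *
          (queryWeights (oracleOf F x y) ({((bitEquiv F x).symm s).1} : Set (List Bool)) gs ψ0).sum)
      = boolAvg (fun y : Fin (numOracleBits F x) → Bool => 4 * (T : ℝ) * ∑ s : Fin (numOracleBits F x),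
          (queryWeights (oracleOf F x y) ({((bitEquiv F x).symm s).1} : Set (List Bool)) gs ψ0).sum) := by
        unfold boolAvg
        rw [← Finset.sum_div]
        congr 1
        rw [Finset.sum_comm]
        refine Finset.sum_congr rfl fun y _ => ?_
        simp only [Finset.mul_sum]
    _ ≤ boolAvg (fun _ : Fin (numOracleBits F x) → Bool => 4 * (T : ℝ) * T) := by
        unfold boolAvg
        exact div_le_div_of_nonneg_right
          (Finset.sum_le_sum fun y _ => mul_le_mul_of_nonneg_left (hpt y) hTnn) (by positivity)
    _ = 4 * (T : ℝ) ^ 2 := by rw [boolAvg_const]; ring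

end Influence

/-! ### The reduction, BBBV form -/

/-- **`OracleSimulation` from the machine half, BBBV form.** Granted stub 1 and PB-AA: if for all `c k`, every
uniform `F` and polynomial `r` there are one `Q ∈ PromiseBQP` and one polynomial-time transcript machine `C` such
that for every `x` (`n ≥ 1`, `T` oracle gates) and every `g` correct on `Q`'s promise there are an advisor
`Adv`, a threshold `τ > 0` and a budget `D ≥ max(1, 8T²/(τδ))` with: every pick a FRESH bit `s ∉ dom ρ` of
averaged BBBV magnitude `m_s(ρ) = E_y[4T·W_{σ(s)}(oracleOf (y ◁ ρ))] ≥ τ`; every refusal certifying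
`m_s(ρ) < w` for every FREE bit `s`; `1/20`-accurate leaf values; and `C^{A ⊕ g}(x)` the threshold bit of
`advTree Adv D` at the bits of `A` — at `δ = 1/(r(n)+1)`, `w = 2^{-k}(((1/10)²δ/2)/2/d)^c`,
`d = thm23Degree F x` — then the average-case simulation relative to the promise oracle holds with error
`≤ 1/(r(n)+1)`. Influences, variances and the hybrid argument are all discharged here.
[cite: AaronsonAmbainis2014, Thm. 23 (proof, p. 14)] [cite: BennettBernsteinBrassardVazirani1997, Thm. 3.3] -/
theorem oracleSimulation_of_bbbvMachines
    (hmach : ∀ (c k : ℕ) (F : QCircuitFamily cliffordT), F.IsUniform → ∀ r : Polynomial ℕ,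
      ∃ Q ∈ Literature.Computability.Cryptography.PromiseBQP, ∃ (C : OracleAlg Bool) (q : Polynomial ℕ),
        C.IsPolyTime Computability.encodingBoolBool ∧
        (∀ (O : Oracle) (x : List Bool), ∀ y ∈ C.queries O (q.eval x.length) x, y.length ≤ q.eval x.length) ∧
        ∀ x : List Bool, 1 ≤ x.length → ∀ g : List Bool → Bool,
          (∀ v ∈ Q.yes, g v = true) → (∀ v ∈ Q.no, g v = false) →
          ∃ (Adv : Advisor (numOracleBits F x)) (τ : ℝ) (D : ℕ),
            0 < τ ∧ 0 < D ∧
            8 * ((F.circ x.length).oracleQueries : ℝ) ^ 2 / (τ * (1 / (((r.eval x.length : ℕ) : ℝ) + 1))) ≤ D ∧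
            (∀ (ρ : List (Fin (numOracleBits F x) × Bool)) (i : Fin (numOracleBits F x)),
              Adv.pick ρ = some i → i ∉ ρ.map Prod.fst ∧
                τ ≤ boolAvg (fun y => 4 * ((F.circ x.length).oracleQueries : ℝ) *
                  (queryWeights (oracleOf F x (ρ.foldr (fun ib z => Function.update z ib.1 ib.2) y))
                    ({((bitEquiv F x).symm i).1} : Set (List Bool)) (F.circ x.length).gates
                    (basisState (padInput x.get (F.ancillas x.length)))).sum)) ∧
            (∀ ρ : List (Fin (numOracleBits F x) × Bool), Adv.pick ρ = none → ∀ i : Fin (numOracleBits F x),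
              i ∉ ρ.map Prod.fst →
                boolAvg (fun y => 4 * ((F.circ x.length).oracleQueries : ℝ) *
                  (queryWeights (oracleOf F x (ρ.foldr (fun ib z => Function.update z ib.1 ib.2) y))
                    ({((bitEquiv F x).symm i).1} : Set (List Bool)) (F.circ x.length).gates
                    (basisState (padInput x.get (F.ancillas x.length)))).sum) <
                (1 / 2 ^ k : ℝ) * ((((1 / 10 : ℝ) ^ 2 * (1 / (((r.eval x.length : ℕ) : ℝ) + 1)) / 2) / 2) /
                    thm23Degree F x) ^ c) ∧
            (∀ ρ : List (Fin (numOracleBits F x) × Bool),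
              |Adv.val ρ - boolAvg (evalBool (restrictPath ρ (acceptPoly F x)))| ≤ 1 / 20) ∧
            ∀ A : Set (List Bool),
              C.run (Oracle.ofLanguage {w : List Bool | ∃ v : List Bool,
                  (w = false :: v ∧ v ∈ A) ∨ (w = true :: v ∧ g v = true)}) (q.eval x.length) x =
                some (decide (1 / 2 ≤ (advTree Adv D []).eval (oracleBits F x A)))) :
    Sig.stub_oracleAcceptPseudoBounded → PseudoBoundedAA → OracleSimulation := by
  refine oracleSimulation_of_magnitudeMachines fun c k F hF r => ?_
  obtain ⟨Q, hQ, C, q, hCpoly, hCq, hC⟩ := hmach c k F hF r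
  refine ⟨Q, hQ, C, q, hCpoly, hCq, fun x hx g hgy hgn => ?_⟩
  obtain ⟨Adv, τ, D, hτ, hD0, hD, hpick, hnone, hval, hrun⟩ := hC x hx g hgy hgn
  -- the BBBV weight
  let f : Fin (numOracleBits F x) → (Fin (numOracleBits F x) → Bool) → ℝ := fun s b =>
    4 * ((F.circ x.length).oracleQueries : ℝ) *
      (queryWeights (oracleOf F x b) ({((bitEquiv F x).symm s).1} : Set (List Bool)) (F.circ x.length).gates
        (basisState (padInput x.get (F.ancillas x.length)))).sum
  have hf0 : ∀ s b, 0 ≤ f s b := fun s b =>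
    mul_nonneg (by positivity) (List.sum_nonneg (queryWeights_nonneg _ _ _ _))
  have hsum : ∑ s, boolAvg (f s) ≤ 4 * ((F.circ x.length).oracleQueries : ℝ) ^ 2 :=
    sum_boolAvg_bbbvWeight_le F x cliffordT_isUnitary_holds
  set δ : ℝ := 1 / (((r.eval x.length : ℕ) : ℝ) + 1) with hδ
  have hδpos : 0 < δ := by positivity
  have hwpos : (0 : ℝ) < (1 / 2 ^ k : ℝ) * ((((1 / 10 : ℝ) ^ 2 * δ / 2) / 2) / thm23Degree F x) ^ c := by
    have hd : (0 : ℝ) < thm23Degree F x := by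
      have : 1 ≤ thm23Degree F x := by unfold thm23Degree; omega
      exact_mod_cast this
    positivity
  refine ⟨Adv, f, τ, D, hτ, hD0, ?_, hf0, hpick, fun ρ hρ i => ?_, hval, hrun⟩
  · -- budget: `2 (Σ_s E f_s)/(τδ) ≤ 8T²/(τδ) ≤ D`
    refine le_trans ?_ hD
    rw [div_le_div_iff_of_pos_right (by positivity)]
    linarith
  · -- refusal: free bits by BBBV + the magnitude clause, revealed bits have influence `0`
    by_cases hi : i ∈ ρ.map Prod.fst
    · rw [influence_restrictPath_eq_zero_of_mem i ρ (acceptPoly F x) hi]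
      exact hwpos
    · exact (influence_restrictPath_acceptPoly_le F x cliffordT_isUnitary_holds ρ i hi).trans_lt (hnone ρ hρ i hi)

/-- **Stub `stub_pbOracleSimulation` from its machine, BBBV form** (see `oracleSimulation_of_bbbvMachines`):
what remains is one `PromiseBQP` problem for gapped magnitude / mean tests and the transcript machine.
[cite: AaronsonAmbainis2014, Thm. 23 (proof, p. 14)] -/
theorem stub_pbOracleSimulation_of_bbbvMachines
    (hmach : ∀ (c k : ℕ) (F : QCircuitFamily cliffordT), F.IsUniform → ∀ r : Polynomial ℕ,
      ∃ Q ∈ Literature.Computability.Cryptography.PromiseBQP, ∃ (C : OracleAlg Bool) (q : Polynomial ℕ),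
        C.IsPolyTime Computability.encodingBoolBool ∧
        (∀ (O : Oracle) (x : List Bool), ∀ y ∈ C.queries O (q.eval x.length) x, y.length ≤ q.eval x.length) ∧
        ∀ x : List Bool, 1 ≤ x.length → ∀ g : List Bool → Bool,
          (∀ v ∈ Q.yes, g v = true) → (∀ v ∈ Q.no, g v = false) →
          ∃ (Adv : Advisor (numOracleBits F x)) (τ : ℝ) (D : ℕ),
            0 < τ ∧ 0 < D ∧
            8 * ((F.circ x.length).oracleQueries : ℝ) ^ 2 / (τ * (1 / (((r.eval x.length : ℕ) : ℝ) + 1))) ≤ D ∧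
            (∀ (ρ : List (Fin (numOracleBits F x) × Bool)) (i : Fin (numOracleBits F x)),
              Adv.pick ρ = some i → i ∉ ρ.map Prod.fst ∧
                τ ≤ boolAvg (fun y => 4 * ((F.circ x.length).oracleQueries : ℝ) *
                  (queryWeights (oracleOf F x (ρ.foldr (fun ib z => Function.update z ib.1 ib.2) y))
                    ({((bitEquiv F x).symm i).1} : Set (List Bool)) (F.circ x.length).gates
                    (basisState (padInput x.get (F.ancillas x.length)))).sum)) ∧
            (∀ ρ : List (Fin (numOracleBits F x) × Bool), Adv.pick ρ = none → ∀ i : Fin (numOracleBits F x),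
              i ∉ ρ.map Prod.fst →
                boolAvg (fun y => 4 * ((F.circ x.length).oracleQueries : ℝ) *
                  (queryWeights (oracleOf F x (ρ.foldr (fun ib z => Function.update z ib.1 ib.2) y))
                    ({((bitEquiv F x).symm i).1} : Set (List Bool)) (F.circ x.length).gates
                    (basisState (padInput x.get (F.ancillas x.length)))).sum) <
                (1 / 2 ^ k : ℝ) * ((((1 / 10 : ℝ) ^ 2 * (1 / (((r.eval x.length : ℕ) : ℝ) + 1)) / 2) / 2) /
                    thm23Degree F x) ^ c) ∧
            (∀ ρ : List (Fin (numOracleBits F x) × Bool),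
              |Adv.val ρ - boolAvg (evalBool (restrictPath ρ (acceptPoly F x)))| ≤ 1 / 20) ∧
            ∀ A : Set (List Bool),
              C.run (Oracle.ofLanguage {w : List Bool | ∃ v : List Bool,
                  (w = false :: v ∧ v ∈ A) ∨ (w = true :: v ∧ g v = true)}) (q.eval x.length) x =
                some (decide (1 / 2 ≤ (advTree Adv D []).eval (oracleBits F x A)))) :
    Sig.stub_pbOracleSimulation :=
  oracleSimulation_of_bbbvMachines hmach

end SimTreePB

end Summit.QuantumAdvantage.QuantumAdvantage.Cruxes.TransferPB.Birth

end
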